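import Summits.QuantumFields.YangMills.Theorems.LuscherReductionTwistedTraceScalingBODefectTailFP
import Summits.QuantumFields.YangMills.Theorems.LuscherReductionTwistedTraceScalingBODefect
import Summits.QuantumFields.YangMills.Theorems.LuscherReductionTwistedTraceScalingBODualProfile
import Summits.QuantumFields.YangMills.Theorems.LuscherReductionTwistedTraceScalingBOCapProfile
import Summits.QuantumFields.YangMills.Theorems.LuscherReductionTwistedTraceScalingRecordBricks
import HarnessLib

/-!
# (C5-T) ★★ THE FADDEEV–POPOV TAIL PIECE OF THE hOD DEFECT: `∫ 𝟙_{S_in}·K_tail²/w ≤ (Z⁻¹·X_tail)²/(N̄(1−κ_P))·‖φ‖₂²`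
# (lane A of S-BASE, crux `TwistedTraceScaling` stmt-QuantumFields-20203, C4-CORE, the (OD) pen; piece `I_tail` of `…BODefectSplit`, `pub/ym-fleet/ym-luscher-20007-p1/HANDOFF-g20.md`)

On the inner set `S_in = {U ∈ orthoTubeSet, χ U ≠ 0, ‖relLinkVec U‖ ≤ r_f/12, slowMean U ∈ W_out(D)}` the transfer of the BO function splits as `K_core + K_tail`
(`…BODefectTailFP.transferApply_boFun_eq_core_add_tail`); the tail part `K_tail(U) = Z⁻¹∫φ(u)·(∫_c T_{Ω_c,W_tail}(c⁻¹Uc, u)dc)du` is uniformly tiny there: every `U ∈ S_in` IS a slice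
point `oT (slowMean U) v` with `‖v̂‖ ≤ r_f`, so `…BODefectTailFP.colour_fpFibreTransfer_tail_le` gives `∫_c T_tail ≤ X_tail := e^{2β|E|}(e^{−β·m_nt} + e^{−β·m_far})·∫Ω_c dπ` for
every `u` in the slow window, whence `|K_tail(U)| ≤ Z⁻¹·X_tail·∫|φ|`; with `1/w ≤ 1/(N̄(1−κ_P))` on the support of `χ` (`…BODualProfile.inv_softWeight_le` + (P)) and
`(∫|φ|)² ≤ ∫φ²` (probability space):
* §1 `abs_tailTransferApply_le` — the pointwise bound `|K_tail(U)| ≤ Z⁻¹·X_tail·∫|φ|` at `U ∈ S_in`;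
* §2 ★★ `tail_sq_integral_le` — `∫ 𝟙_{S_in}·K_tail²/w ≤ (Z⁻¹X_tail)²·(1/(N̄(1−κ_P)))·∫φ²` (β-pointwise, the six side conditions of the tail lemma as hypotheses; on schedule B
  they hold eventually and `β·m_nt, β·m_far ≳ log⁴β` — `…BTProfileBudget`, next file — so `X_tail = e^{2β|E|}·O(e^{−c log⁴β})`, superpolynomially small against the polynomial floor
  `…BOBtCPolyFloor.btC_record_poly_floor` of the hOD currency).
HONEST FRAMING: one piece of (C5) for a stub of a child of the CONDITIONAL route R2b1; (C5)-out (stiff separation), the hOD assembly, (B-ST), C4-CORE OPEN; not infinite volume, not a gap,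
not Clay.
-/

set_option autoImplicit false

noncomputable section

open MeasureTheory Filter Topology Real
open scoped BigOperators RealInnerProductSpace
open Literature.MathematicalPhysics.QuantumFieldTheory
open Literature.MathematicalPhysics.QuantumLattice

namespace Summit.QuantumFields.YangMills.Theorems.FemtoTransferGap.TwoLattice.ConstTube

open Summit.QuantumFields.YangMills.Theorems.FemtoTransferGap
open Summit.QuantumFields.YangMills.Theorems.FemtoTransferGap.TwoLattice
open Summit.QuantumFields.YangMills.Theorems.FemtoTransferGap.TwoLattice.Avg
open Summit.QuantumFields.YangMills.Theorems.FemtoTransferGap.TwoLattice.Stiff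
open Summit.QuantumFields.YangMills.Theorems.FemtoTransferGap.TwoLattice.GnChart

variable {L : ℕ} [NeZero L]

/-! ## §1 The tail transfer of the BO function is uniformly tiny on the inner set -/

set_option maxHeartbeats 800000 in
-- the record profile / weight / window expressions are large.
/-- **THE FP TAIL AT AN INNER POINT**: at `U ∈ S_in` (so `U = oT u' v'` with `u'` in the slow window `W_out(D)` and `‖v̂'‖ ≤ r_f/12`), for `φ` supported in the slow window
`‖q(u_k) − 1‖ ≤ δ` (`Dβ^{-s} ≤ δ`) and the six side conditions of `colour_fpFibreTransfer_tail_le` at `(δ, α, R = r_f, R₁', ε, P₀)`: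
`|K_tail(U)| ≤ Z⁻¹·X_tail·∫|φ|`. [cite: Luscher1983, §3] -/
theorem abs_tailTransferApply_le {β : ℝ} (hβ : 0 ≤ β) {s M D δ α P₀ : ℝ} (hDδ : D * powScale s β ≤ δ)
    (hLa : 18 * L * (Real.sqrt 2 * (min (1 / 40) (powScale (1 / 2) β * btLog β)) + δ) ≤ 1 / 2)
    (hm₁ : 0 ≤ (5 * (powScale (1 / 2) β * btLog β ^ 2)) / 2 - 2 * (Real.sqrt 2 * (min (1 / 40) (powScale (1 / 2) β * btLog β)) + δ) * (powScale 1 β) - (2 * Real.sqrt 2 * (min (1 / 40) (powScale (1 / 2) β * btLog β)) + α))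
    (hm₂ : 0 ≤ 1 / (3 * L) - 4 * (Real.sqrt 2 * (min (1 / 40) (powScale (1 / 2) β * btLog β)) + δ) - (2 * Real.sqrt 2 * (min (1 / 40) (powScale (1 / 2) β * btLog β)) + α))
    (hP : 3 * L * P₀ < 1) (hP0 : 0 ≤ P₀ - 4 * (Real.sqrt 2 * (min (1 / 40) (powScale (1 / 2) β * btLog β)) + δ) - (2 * Real.sqrt 2 * (min (1 / 40) (powScale (1 / 2) β * btLog β)) + 2 * δ))
    (hJ : 2 * (powScale 1 β) * Fintype.card (Site 3 L) * δ + 2 * (min (1 / 40) (powScale (1 / 2) β * btLog β)) ^ 2 + 2 * Real.sqrt 2 * Fintype.card (Site 3 L) * (9 * L * P₀ + (powScale 1 β)) * (min (1 / 40) (powScale (1 / 2) β * btLog β)) ≤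
      Fintype.card (Site 3 L) * (1 - 3 * L * P₀) * α)
    {φ : GaugeConfig 3 1 SU2 → ℝ} (hφm : Measurable φ) {Cφ : ℝ} (hCφ : ∀ u, |φ u| ≤ Cφ) (hφw : ∀ u, φ u ≠ 0 → ∀ k : Fin 3, ‖su2Quat (u (0, k)) - 1‖ ≤ δ)
    {U : GaugeConfig 3 L SU2} (hU : U ∈ {U : GaugeConfig 3 L SU2 | U ∈ orthoTubeSet L ∧ (recordChi L s 43 M β) U ≠ 0 ∧ ‖relLinkVec L U‖ ≤ (min (1 / 40) (powScale (1 / 2) β * btLog β)) / 12 ∧ slowMean L U ∈ {u : GaugeConfig 3 1 SU2 | (∀ k : Fin 3, ‖su2Quat (u (0, k)) - 1‖ ≤ (D * powScale s β)) ∧ (L : ℝ) ^ 3 * wilsonAction su2Rep u ≤ (powScale (2 * s) β)}}) :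
    |(fun U : GaugeConfig 3 L SU2 => (fpZ (powScale 1 β))⁻¹ * ∫ u, φ u * (∫ c, fpFibreTransfer L β (fun x : LinkSpace L => {x : LinkSpace L | linkCurry x ∈ capBalancedSet L}.indicator (fun _ => (1 : ℝ)) x * frozenProfile L (fun β' => stiffGaussExp L (β' / 2) β') (fun β' => min (1 / 40) (powScale (1 / 2) β' * btLog β')) β x) (tailWeight L (powScale 1 β) (5 * (powScale (1 / 2) β * btLog β ^ 2))) (gaugeTransform (fun _ : Site 3 L => c⁻¹) U) u ∂haarProbability SU2) ∂configMeasure SU2 1) U| ≤ (fpZ (powScale 1 β))⁻¹ * (Real.exp (β * (2 * (Fintype.card (Edge 3 L) : ℝ))) * (Real.exp (-(β * btMnt L δ α (min (1 / 40) (powScale (1 / 2) β * btLog β)) (5 * (powScale (1 / 2) β * btLog β ^ 2)) (powScale 1 β))) + Real.exp (-(β * btMfar L δ α (min (1 / 40) (powScale (1 / 2) β * btLog β)) (powScale 1 β) P₀))) * ∫ v, (fun x : LinkSpace L => {x : LinkSpace L | linkCurry x ∈ capBalancedSet L}.indicator (fun _ => (1 : ℝ)) x * frozenProfile L (fun β'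 => stiffGaussExp L (β' / 2) β') (fun β' => min (1 / 40) (powScale (1 / 2) β' * btLog β')) β x) (linkEmbed L v) ∂orthoTransverse L) * ∫ u, |φ u| ∂configMeasure SU2 1 := by
  obtain ⟨hUT, -, hUR, hUW⟩ := hU
  obtain ⟨u', v', hv', rfl⟩ := hUT
  rw [slowMean_orthoTube L u' hv'] at hUW
  rw [relLinkVec_orthoTube L u' hv'] at hUR
  obtain ⟨hu'1, -⟩ := hUW
  -- profile data
  have hqfm : ∀ β', Measurable ((fun β' => stiffGaussExp L (β' / 2) β') β') := fun β' => measurable_stiffGaussExp _ _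
  have hqf0 : ∀ β' x, 0 ≤ (fun β' => stiffGaussExp L (β' / 2) β') β' x := fun β' x => stiffGaussExp_nonneg _ _ x
  have hΩGm : Measurable (frozenProfile L (fun β' => stiffGaussExp L (β' / 2) β') (fun β' => min (1 / 40) (powScale (1 / 2) β' * btLog β')) β) := measurable_frozenProfile hqfm _ β
  have hΩG0 : ∀ x, 0 ≤ frozenProfile L (fun β' => stiffGaussExp L (β' / 2) β') (fun β' => min (1 / 40) (powScale (1 / 2) β' * btLog β')) β x := fun x => (frozenProfile_mem_Icc hqf0 _ β x).1
  have hΩG1 : ∀ x, |frozenProfile L (fun β' => stiffGaussExp L (β' / 2) β') (fun β' => min (1 / 40) (powScale (1 / 2) β' * btLog β')) β x| ≤ 1 := abs_frozenProfile_le hqf0 _ β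
  have hΩm := measurable_capRestrict (L := L) hΩGm
  have hΩdat := fun x => capRestrict_mem (L := L) hΩG0 hΩG1 x
  have hΩt : ∀ v : Edge 3 L → Fin 3 → ℝ, (fun x : LinkSpace L => {x : LinkSpace L | linkCurry x ∈ capBalancedSet L}.indicator (fun _ => (1 : ℝ)) x * frozenProfile L (fun β' => stiffGaussExp L (β' / 2) β') (fun β' => min (1 / 40) (powScale (1 / 2) β' * btLog β')) β x) (linkEmbed L v) ≠ 0 → ‖linkEmbed L v‖ ≤ (min (1 / 40) (powScale (1 / 2) β * btLog β)) := fun v hv =>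
    (capRestrict_frozenProfile_support (L := L) (fun β' => stiffGaussExp L (β' / 2) β') (fun β' => min (1 / 40) (powScale (1 / 2) β' * btLog β')) β v hv).2.2
  have hx0 : 0 < powScale (1 / 2) β := powScale_pos _ _
  have hℓ0 : 0 ≤ btLog β := le_trans zero_le_one (one_le_btLog β)
  have hrf0 : 0 ≤ (min (1 / 40) (powScale (1 / 2) β * btLog β)) := le_min (by norm_num) (mul_nonneg hx0.le hℓ0)
  have hv'R : ‖linkEmbed L v'‖ ≤ (min (1 / 40) (powScale (1 / 2) β * btLog β)) := hUR.trans (by linarith)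
  have hδ' : ∀ k : Fin 3, ‖su2Quat (u' (0, k)) - 1‖ ≤ δ := fun k => (hu'1 k).trans hDδ
  have hW0 : ∀ g, 0 ≤ (tailWeight L (powScale 1 β) (5 * (powScale (1 / 2) β * btLog β ^ 2))) g := fun g => (tailWeight_mem_Icc (L := L) _ _ g).1
  -- the bound `X_tail` at every `u` in the window
  have hX : ∀ u : GaugeConfig 3 1 SU2, φ u ≠ 0 →
      ∫ c, fpFibreTransfer L β (fun x : LinkSpace L => {x : LinkSpace L | linkCurry x ∈ capBalancedSet L}.indicator (fun _ => (1 : ℝ)) x * frozenProfile L (fun β' => stiffGaussExp L (β' / 2) β') (fun β' => min (1 / 40) (powScale (1 / 2) β' * btLog β')) β x) (tailWeight L (powScale 1 β) (5 * (powScale (1 / 2) β * btLog β ^ 2))) (gaugeTransform (fun _ : Site 3 L => c⁻¹) (orthoTube L u' v')) u ∂haarProbability SU2 ≤ (Real.exp (β * (2 * (Fintype.card (Edge 3 L) : ℝ))) * (Real.exp (-(β * btMnt L δ α (min (1 / 40) (powScale (1 / 2) β * btLog β)) (5 * (powScale (1 / 2) β * btLog β ^ 2)) (powScale 1 β))) +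 Real.exp (-(β * btMfar L δ α (min (1 / 40) (powScale (1 / 2) β * btLog β)) (powScale 1 β) P₀))) * ∫ v, (fun x : LinkSpace L => {x : LinkSpace L | linkCurry x ∈ capBalancedSet L}.indicator (fun _ => (1 : ℝ)) x * frozenProfile L (fun β' => stiffGaussExp L (β' / 2) β') (fun β' => min (1 / 40) (powScale (1 / 2) β' * btLog β')) β x) (linkEmbed L v) ∂orthoTransverse L) :=
    fun u hu => colour_fpFibreTransfer_tail_le (L := L) hβ hΩm (fun x => (hΩdat x).2.2) (fun x => (hΩdat x).1) hΩt (powScale_pos 1 β).le u' u hv' hv'R hδ' (hφw u hu)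
      hLa hm₁ hm₂ hP hP0 hJ
  have hI0 : ∀ u : GaugeConfig 3 1 SU2, 0 ≤ ∫ c, fpFibreTransfer L β (fun x : LinkSpace L => {x : LinkSpace L | linkCurry x ∈ capBalancedSet L}.indicator (fun _ => (1 : ℝ)) x * frozenProfile L (fun β' => stiffGaussExp L (β' / 2) β') (fun β' => min (1 / 40) (powScale (1 / 2) β' * btLog β')) β x) (tailWeight L (powScale 1 β) (5 * (powScale (1 / 2) β * btLog β ^ 2))) (gaugeTransform (fun _ : Site 3 L => c⁻¹) (orthoTube L u' v')) u ∂haarProbability SU2 :=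
    fun u => integral_nonneg fun c => fpFibreTransfer_nonneg β (fun x => (hΩdat x).1) hW0 _ u
  have hX0 : 0 ≤ (Real.exp (β * (2 * (Fintype.card (Edge 3 L) : ℝ))) * (Real.exp (-(β * btMnt L δ α (min (1 / 40) (powScale (1 / 2) β * btLog β)) (5 * (powScale (1 / 2) β * btLog β ^ 2)) (powScale 1 β))) + Real.exp (-(β * btMfar L δ α (min (1 / 40) (powScale (1 / 2) β * btLog β)) (powScale 1 β) P₀))) * ∫ v, (fun x : LinkSpace L => {x : LinkSpace L | linkCurry x ∈ capBalancedSet L}.indicator (fun _ => (1 : ℝ)) x * frozenProfile L (fun β' => stiffGaussExp L (β' / 2) β') (fun β' => min (1 / 40) (powScale (1 / 2) β' * btLog β')) β x) (linkEmbed L v) ∂orthoTransverse L) := by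
    by_cases h : ∃ u, φ u ≠ 0
    · obtain ⟨u, hu⟩ := h; exact (hI0 u).trans (hX u hu)
    · exact mul_nonneg (mul_nonneg (Real.exp_pos _).le (add_nonneg (Real.exp_pos _).le (Real.exp_pos _).le)) (integral_nonneg fun v => (hΩdat _).1)
  have hZi : 0 ≤ (fpZ (powScale 1 β))⁻¹ := (inv_pos.2 (fpZ_pos (powScale_pos 1 β))).le
  -- `|∫ φ·I| ≤ ∫ |φ|·X`
  have hint : Integrable (fun u => (Real.exp (β * (2 * (Fintype.card (Edge 3 L) : ℝ))) * (Real.exp (-(β * btMnt L δ α (min (1 / 40) (powScale (1 / 2) β * btLog β)) (5 * (powScale (1 / 2) β * btLog β ^ 2)) (powScale 1 β))) + Real.exp (-(β * btMfar L δ α (min (1 / 40) (powScale (1 / 2) β * btLog β)) (powScale 1 β) P₀))) * ∫ v, (fun x : LinkSpace L => {x : LinkSpace L | linkCurry x ∈ capBalancedSet L}.indicator (fun _ => (1 : ℝ)) x * frozenProfile L (fun β' => stiffGaussExp L (β' / 2) β') (fun β' => min (1 / 40) (powScale (1 / 2) β' * btLog β')) β x) (linkEmbed L v) ∂orthoTransverse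 L) * |φ u|) (configMeasure SU2 1) :=
    (integrable_of_measurable_abs_le _ hφm.abs (C := Cφ) (fun u => by rw [abs_abs]; exact hCφ u)).const_mul _
  have hpt : ∀ u, |φ u * ∫ c, fpFibreTransfer L β (fun x : LinkSpace L => {x : LinkSpace L | linkCurry x ∈ capBalancedSet L}.indicator (fun _ => (1 : ℝ)) x * frozenProfile L (fun β' => stiffGaussExp L (β' / 2) β') (fun β' => min (1 / 40) (powScale (1 / 2) β' * btLog β')) β x) (tailWeight L (powScale 1 β) (5 * (powScale (1 / 2) β * btLog β ^ 2))) (gaugeTransform (fun _ : Site 3 L => c⁻¹) (orthoTube L u' v')) u ∂haarProbability SU2| ≤ (Real.exp (β * (2 * (Fintype.card (Edge 3 L) : ℝ))) * (Real.exp (-(β * btMnt L δ α (min (1 / 40) (powScale (1 / 2) β * btLog β)) (5 * (powScale (1 / 2) β * btLog β ^ 2)) (powScale 1 β))) + Real.exp (-(β * btMfar L δ α (min (1 / 40) (powScale (1 / 2) β * btLog β)) (powScale 1 β) P₀))) * ∫ v, (fun x : LinkSpace L => {x : LinkSpace L | linkCurry x ∈ capBalancedSet L}.indicator (fun _ =>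 (1 : ℝ)) x * frozenProfile L (fun β' => stiffGaussExp L (β' / 2) β') (fun β' => min (1 / 40) (powScale (1 / 2) β' * btLog β')) β x) (linkEmbed L v) ∂orthoTransverse L) * |φ u| := by
    intro u
    by_cases hu : φ u = 0
    · rw [hu]; simp
    · rw [abs_mul, abs_of_nonneg (hI0 u), mul_comm]
      exact mul_le_mul_of_nonneg_right (hX u hu) (abs_nonneg _)
  dsimp only
  rw [abs_mul, abs_of_nonneg hZi, mul_assoc]
  refine mul_le_mul_of_nonneg_left ?_ hZi
  calc |∫ u, φ u * ∫ c, fpFibreTransfer L β (fun x : LinkSpace L => {x : LinkSpace L | linkCurry x ∈ capBalancedSet L}.indicator (fun _ => (1 : ℝ)) x * frozenProfile L (fun β' => stiffGaussExp L (β' / 2) β') (fun β' => min (1 / 40) (powScale (1 / 2) β' * btLog β')) β x) (tailWeight L (powScale 1 β) (5 * (powScale (1 / 2) β * btLog β ^ 2))) (gaugeTransform (fun _ : Site 3 L => c⁻¹) (orthoTube L u' v')) u ∂haarProbability SU2 ∂configMeasure SU2 1|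
      ≤ ∫ u, |φ u * ∫ c, fpFibreTransfer L β (fun x : LinkSpace L => {x : LinkSpace L | linkCurry x ∈ capBalancedSet L}.indicator (fun _ => (1 : ℝ)) x * frozenProfile L (fun β' => stiffGaussExp L (β' / 2) β') (fun β' => min (1 / 40) (powScale (1 / 2) β' * btLog β')) β x) (tailWeight L (powScale 1 β) (5 * (powScale (1 / 2) β * btLog β ^ 2))) (gaugeTransform (fun _ : Site 3 L => c⁻¹) (orthoTube L u' v')) u ∂haarProbability SU2| ∂configMeasure SU2 1 :=
        abs_integral_le_integral_abs
    _ ≤ ∫ u, (Real.exp (β * (2 * (Fintype.card (Edge 3 L) : ℝ))) * (Real.exp (-(β * btMnt L δ α (min (1 / 40) (powScale (1 / 2) β * btLog β)) (5 * (powScale (1 / 2) β * btLog β ^ 2)) (powScale 1 β))) + Real.exp (-(β * btMfar L δ α (min (1 / 40) (powScale (1 / 2) β * btLog β)) (powScale 1 β) P₀))) * ∫ v, (fun x : LinkSpace L => {x : LinkSpace L | linkCurry x ∈ capBalancedSet L}.indicator (fun _ => (1 : ℝ)) x * frozenProfile L (fun β' => stiffGaussExp L (β' / 2) β') (fun β'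 => min (1 / 40) (powScale (1 / 2) β' * btLog β')) β x) (linkEmbed L v) ∂orthoTransverse L) * |φ u| ∂configMeasure SU2 1 := integral_mono_of_nonneg (ae_of_all _ fun u => abs_nonneg _) hint (ae_of_all _ hpt)
    _ = (Real.exp (β * (2 * (Fintype.card (Edge 3 L) : ℝ))) * (Real.exp (-(β * btMnt L δ α (min (1 / 40) (powScale (1 / 2) β * btLog β)) (5 * (powScale (1 / 2) β * btLog β ^ 2)) (powScale 1 β))) + Real.exp (-(β * btMfar L δ α (min (1 / 40) (powScale (1 / 2) β * btLog β)) (powScale 1 β) P₀))) * ∫ v, (fun x : LinkSpace L => {x : LinkSpace L | linkCurry x ∈ capBalancedSet L}.indicator (fun _ => (1 : ℝ)) x * frozenProfile L (fun β' => stiffGaussExp L (β' / 2) β') (fun β' => min (1 / 40) (powScale (1 / 2) β' * btLog β')) β x) (linkEmbed L v) ∂orthoTransverse L) * ∫ u, |φ u| ∂configMeasure SU2 1 := integral_const_mul _ _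

/-! ## §2 ★★ The tail piece, integrated -/

set_option maxHeartbeats 800000 in
-- as above.
/-- ★★ **THE FP TAIL PIECE OF THE hOD DEFECT** (β-pointwise): under (P) (`N ≥ N̄(1−κ_P) > 0` on the fat tube), the slow-window support of `φ` and the six side conditions,
`∫ 𝟙_{S_in}·K_tail²/w ≤ (Z⁻¹·X_tail)²·(1/(N̄(1−κ_P)))·∫φ²`. [cite: Luscher1983, §3] -/
theorem tail_sq_integral_le {β : ℝ} (hβ : 0 ≤ β) {s M D δ α P₀ Nbar κP : ℝ} (hNκ : 0 < Nbar * (1 - κP))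
    (hPlo : ∀ U ∈ fatTubeRho L (fun β => 43 * powScale s β) (fun b => M * (43 * powScale s b)) β, Nbar * (1 - κP) ≤ gaugeAvg (recordChi L s 43 M β) U)
    (hDδ : D * powScale s β ≤ δ)
    (hLa : 18 * L * (Real.sqrt 2 * (min (1 / 40) (powScale (1 / 2) β * btLog β)) + δ) ≤ 1 / 2)
    (hm₁ : 0 ≤ (5 * (powScale (1 / 2) β * btLog β ^ 2)) / 2 - 2 * (Real.sqrt 2 * (min (1 / 40) (powScale (1 / 2) β * btLog β)) + δ) * (powScale 1 β) - (2 * Real.sqrt 2 * (min (1 / 40) (powScale (1 / 2) β * btLog β)) + α))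
    (hm₂ : 0 ≤ 1 / (3 * L) - 4 * (Real.sqrt 2 * (min (1 / 40) (powScale (1 / 2) β * btLog β)) + δ) - (2 * Real.sqrt 2 * (min (1 / 40) (powScale (1 / 2) β * btLog β)) + α))
    (hP : 3 * L * P₀ < 1) (hP0 : 0 ≤ P₀ - 4 * (Real.sqrt 2 * (min (1 / 40) (powScale (1 / 2) β * btLog β)) + δ) - (2 * Real.sqrt 2 * (min (1 / 40) (powScale (1 / 2) β * btLog β)) + 2 * δ))
    (hJ : 2 * (powScale 1 β) * Fintype.card (Site 3 L) * δ + 2 * (min (1 / 40) (powScale (1 / 2) β * btLog β)) ^ 2 + 2 * Real.sqrt 2 * Fintype.card (Site 3 L) * (9 * L * P₀ + (powScale 1 β)) * (min (1 / 40) (powScale (1 / 2) β * btLog β)) ≤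
      Fintype.card (Site 3 L) * (1 - 3 * L * P₀) * α)
    {φ : GaugeConfig 3 1 SU2 → ℝ} (hφm : Measurable φ) {Cφ : ℝ} (hCφ : ∀ u, |φ u| ≤ Cφ) (hφw : ∀ u, φ u ≠ 0 → ∀ k : Fin 3, ‖su2Quat (u (0, k)) - 1‖ ≤ δ) :
    ∫ U, {U : GaugeConfig 3 L SU2 | U ∈ orthoTubeSet L ∧ (recordChi L s 43 M β) U ≠ 0 ∧ ‖relLinkVec L U‖ ≤ (min (1 / 40) (powScale (1 / 2) β * btLog β)) / 12 ∧ slowMean L U ∈ {u : GaugeConfig 3 1 SU2 | (∀ k : Fin 3, ‖su2Quat (u (0, k)) - 1‖ ≤ (D * powScale s β)) ∧ (L : ℝ) ^ 3 * wilsonAction su2Rep u ≤ (powScale (2 * s) β)}}.indicator (fun _ => (1 : ℝ)) U * ((fun U : GaugeConfig 3 L SU2 => (fpZ (powScale 1 β))⁻¹ * ∫ u, φ u * (∫ c, fpFibreTransfer L β (fun x : LinkSpace L => {x : LinkSpace L | linkCurry x ∈ capBalancedSet L}.indicator (fun _ => (1 : ℝ)) x * frozenProfile L (fun β' => stiffGaussExp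 L (β' / 2) β') (fun β' => min (1 / 40) (powScale (1 / 2) β' * btLog β')) β x) (tailWeight L (powScale 1 β) (5 * (powScale (1 / 2) β * btLog β ^ 2))) (gaugeTransform (fun _ : Site 3 L => c⁻¹) U) u ∂haarProbability SU2) ∂configMeasure SU2 1) U ^ 2 / softWeight (recordChi L s 43 M β) U) ∂configMeasure SU2 L ≤
      ((fpZ (powScale 1 β))⁻¹ * (Real.exp (β * (2 * (Fintype.card (Edge 3 L) : ℝ))) * (Real.exp (-(β * btMnt L δ α (min (1 / 40) (powScale (1 / 2) β * btLog β)) (5 * (powScale (1 / 2) β * btLog β ^ 2)) (powScale 1 β))) + Real.exp (-(β * btMfar L δ α (min (1 / 40) (powScale (1 / 2) β * btLog β)) (powScale 1 β) P₀))) * ∫ v, (fun x : LinkSpace L => {x : LinkSpace L | linkCurry x ∈ capBalancedSet L}.indicator (fun _ => (1 : ℝ)) x * frozenProfile L (fun β' => stiffGaussExp L (β' / 2) β') (fun β' => min (1 / 40) (powScale (1 / 2) β' * btLog β')) β x) (linkEmbed L v) ∂orthoTransverse L)) ^ 2 * (1 / (Nbar * (1 - κP))) * ∫ u, φ u ^ 2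 ∂configMeasure SU2 1 := by
  obtain ⟨hχm, hχ1, hχ0, hχF⟩ := recordChi_props (L := L) s 43 M β
  obtain ⟨hwm, hwb, hw0, -⟩ := softWeight_recordChi_props (L := L) s 43 M β
  set A : ℝ := ∫ u, |φ u| ∂configMeasure SU2 1 with hAdef
  have hA2 : A ^ 2 ≤ ∫ u, φ u ^ 2 ∂configMeasure SU2 1 := by
    have h := sq_integral_mul_mul_le (configMeasure SU2 1) hφm.abs measurable_const measurable_const (a := fun u => |φ u|) (b := fun _ => (1 : ℝ)) (w := fun _ => (1 : ℝ))
      (Ca := Cφ) (Cb := 1) (Cw := 1) (fun u => by rw [abs_abs]; exact hCφ u) (fun _ => by rw [abs_one]) (fun _ => by rw [abs_one]) (fun _ => zero_le_one)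
    simp only [mul_one, one_pow, integral_const, smul_eq_mul, probReal_univ, sq_abs] at h
    rw [hAdef]; simpa using h
  set CT : ℝ := ((fpZ (powScale 1 β))⁻¹ * (Real.exp (β * (2 * (Fintype.card (Edge 3 L) : ℝ))) * (Real.exp (-(β * btMnt L δ α (min (1 / 40) (powScale (1 / 2) β * btLog β)) (5 * (powScale (1 / 2) β * btLog β ^ 2)) (powScale 1 β))) + Real.exp (-(β * btMfar L δ α (min (1 / 40) (powScale (1 / 2) β * btLog β)) (powScale 1 β) P₀))) * ∫ v, (fun x : LinkSpace L => {x : LinkSpace L | linkCurry x ∈ capBalancedSet L}.indicator (fun _ => (1 : ℝ)) x * frozenProfile L (fun β' => stiffGaussExp L (β' / 2) β') (fun β' => min (1 / 40) (powScale (1 / 2) β' * btLog β')) β x) (linkEmbed L v) ∂orthoTransverse L) * A) ^ 2 * (1 / (Nbar * (1 - κP))) with hCTdef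
  have hCT0 : 0 ≤ CT := by rw [hCTdef]; exact mul_nonneg (sq_nonneg _) (div_pos one_pos hNκ).le
  -- pointwise bound by the constant `CT`
  have hpt : ∀ U, {U : GaugeConfig 3 L SU2 | U ∈ orthoTubeSet L ∧ (recordChi L s 43 M β) U ≠ 0 ∧ ‖relLinkVec L U‖ ≤ (min (1 / 40) (powScale (1 / 2) β * btLog β)) / 12 ∧ slowMean L U ∈ {u : GaugeConfig 3 1 SU2 | (∀ k : Fin 3, ‖su2Quat (u (0, k)) - 1‖ ≤ (D * powScale s β)) ∧ (L : ℝ) ^ 3 * wilsonAction su2Rep u ≤ (powScale (2 * s) β)}}.indicator (fun _ => (1 : ℝ)) U * ((fun U : GaugeConfig 3 L SU2 => (fpZ (powScale 1 β))⁻¹ * ∫ u, φ u * (∫ c, fpFibreTransfer L β (fun x : LinkSpace L => {x : LinkSpace L | linkCurry x ∈ capBalancedSet L}.indicator (fun _ => (1 : ℝ)) x * frozenProfile L (fun β' => stiffGaussExp L (β' / 2) β') (fun β' => min (1 / 40) (powScale (1 / 2) β' * btLog β')) β x) (tailWeight L (powScale 1 β) (5 * (powScale (1 / 2) β * btLog β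 ^ 2))) (gaugeTransform (fun _ : Site 3 L => c⁻¹) U) u ∂haarProbability SU2) ∂configMeasure SU2 1) U ^ 2 / softWeight (recordChi L s 43 M β) U) ≤ CT := by
    intro U
    by_cases hU : U ∈ {U : GaugeConfig 3 L SU2 | U ∈ orthoTubeSet L ∧ (recordChi L s 43 M β) U ≠ 0 ∧ ‖relLinkVec L U‖ ≤ (min (1 / 40) (powScale (1 / 2) β * btLog β)) / 12 ∧ slowMean L U ∈ {u : GaugeConfig 3 1 SU2 | (∀ k : Fin 3, ‖su2Quat (u (0, k)) - 1‖ ≤ (D * powScale s β)) ∧ (L : ℝ) ^ 3 * wilsonAction su2Rep u ≤ (powScale (2 * s) β)}}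
    · rw [Set.indicator_of_mem hU, one_mul]
      have hK := abs_tailTransferApply_le (L := L) hβ hDδ hLa hm₁ hm₂ hP hP0 hJ hφm hCφ hφw hU
      have hUF := (hχF U hU.2.1).2
      have hwinv := inv_softWeight_le (χ := (recordChi L s 43 M β)) ((le_abs_self _).trans (hχ1 U)) hNκ (hPlo U hUF)
      rw [div_eq_mul_inv, hCTdef]
      have hsq : (fun U : GaugeConfig 3 L SU2 => (fpZ (powScale 1 β))⁻¹ * ∫ u, φ u * (∫ c, fpFibreTransfer L β (fun x : LinkSpace L => {x : LinkSpace L | linkCurry x ∈ capBalancedSet L}.indicator (fun _ => (1 : ℝ)) x * frozenProfile L (fun β' => stiffGaussExp L (β' / 2) β') (fun β' => min (1 / 40) (powScale (1 / 2) β' * btLog β')) β x) (tailWeight L (powScale 1 β) (5 * (powScale (1 / 2) β * btLog β ^ 2))) (gaugeTransform (fun _ : Site 3 L => c⁻¹) U) u ∂haarProbability SU2) ∂configMeasure SU2 1) U ^ 2 ≤ ((fpZ (powScale 1 β))⁻¹ * (Real.exp (β * (2 * (Fintype.card (Edge 3 L) : ℝ))) * (Real.exp (-(β * btMnt L δ α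 (min (1 / 40) (powScale (1 / 2) β * btLog β)) (5 * (powScale (1 / 2) β * btLog β ^ 2)) (powScale 1 β))) + Real.exp (-(β * btMfar L δ α (min (1 / 40) (powScale (1 / 2) β * btLog β)) (powScale 1 β) P₀))) * ∫ v, (fun x : LinkSpace L => {x : LinkSpace L | linkCurry x ∈ capBalancedSet L}.indicator (fun _ => (1 : ℝ)) x * frozenProfile L (fun β' => stiffGaussExp L (β' / 2) β') (fun β' => min (1 / 40) (powScale (1 / 2) β' * btLog β')) β x) (linkEmbed L v) ∂orthoTransverse L) * A) ^ 2 := by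
        rw [← sq_abs ((fun U : GaugeConfig 3 L SU2 => (fpZ (powScale 1 β))⁻¹ * ∫ u, φ u * (∫ c, fpFibreTransfer L β (fun x : LinkSpace L => {x : LinkSpace L | linkCurry x ∈ capBalancedSet L}.indicator (fun _ => (1 : ℝ)) x * frozenProfile L (fun β' => stiffGaussExp L (β' / 2) β') (fun β' => min (1 / 40) (powScale (1 / 2) β' * btLog β')) β x) (tailWeight L (powScale 1 β) (5 * (powScale (1 / 2) β * btLog β ^ 2))) (gaugeTransform (fun _ : Site 3 L => c⁻¹) U) u ∂haarProbability SU2) ∂configMeasure SU2 1) U)]; exact pow_le_pow_left₀ (abs_nonneg _) hK 2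
      exact mul_le_mul hsq hwinv (inv_nonneg.2 (hw0 U)) (sq_nonneg _)
    · rw [Set.indicator_of_notMem hU, zero_mul]; exact hCT0
  have hnn : ∀ U, 0 ≤ {U : GaugeConfig 3 L SU2 | U ∈ orthoTubeSet L ∧ (recordChi L s 43 M β) U ≠ 0 ∧ ‖relLinkVec L U‖ ≤ (min (1 / 40) (powScale (1 / 2) β * btLog β)) / 12 ∧ slowMean L U ∈ {u : GaugeConfig 3 1 SU2 | (∀ k : Fin 3, ‖su2Quat (u (0, k)) - 1‖ ≤ (D * powScale s β)) ∧ (L : ℝ) ^ 3 * wilsonAction su2Rep u ≤ (powScale (2 * s) β)}}.indicator (fun _ => (1 : ℝ)) U * ((fun U : GaugeConfig 3 L SU2 => (fpZ (powScale 1 β))⁻¹ * ∫ u, φ u * (∫ c, fpFibreTransfer L β (fun x : LinkSpace L => {x : LinkSpace L | linkCurry x ∈ capBalancedSet L}.indicator (fun _ => (1 : ℝ)) x * frozenProfile L (fun β' => stiffGaussExp L (β' / 2) β') (fun β' => min (1 / 40) (powScale (1 / 2) β' * btLog β')) β x) (tailWeight L (powScale 1 β) (5 * (powScale (1 / 2)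 β * btLog β ^ 2))) (gaugeTransform (fun _ : Site 3 L => c⁻¹) U) u ∂haarProbability SU2) ∂configMeasure SU2 1) U ^ 2 / softWeight (recordChi L s 43 M β) U) :=
    fun U => mul_nonneg (Set.indicator_nonneg (fun _ _ => zero_le_one) _) (div_nonneg (sq_nonneg _) (hw0 U))
  calc ∫ U, {U : GaugeConfig 3 L SU2 | U ∈ orthoTubeSet L ∧ (recordChi L s 43 M β) U ≠ 0 ∧ ‖relLinkVec L U‖ ≤ (min (1 / 40) (powScale (1 / 2) β * btLog β)) / 12 ∧ slowMean L U ∈ {u : GaugeConfig 3 1 SU2 | (∀ k : Fin 3, ‖su2Quat (u (0, k)) - 1‖ ≤ (D * powScale s β)) ∧ (L : ℝ) ^ 3 * wilsonAction su2Rep u ≤ (powScale (2 * s) β)}}.indicator (fun _ => (1 : ℝ)) U * ((fun U : GaugeConfig 3 L SU2 => (fpZ (powScale 1 β))⁻¹ * ∫ u, φ u * (∫ c, fpFibreTransfer L β (fun x : LinkSpace L => {x : LinkSpace L | linkCurry x ∈ capBalancedSet L}.indicator (fun _ => (1 : ℝ)) x * frozenProfile L (fun β' => stiffGaussExp L (β'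 / 2) β') (fun β' => min (1 / 40) (powScale (1 / 2) β' * btLog β')) β x) (tailWeight L (powScale 1 β) (5 * (powScale (1 / 2) β * btLog β ^ 2))) (gaugeTransform (fun _ : Site 3 L => c⁻¹) U) u ∂haarProbability SU2) ∂configMeasure SU2 1) U ^ 2 / softWeight (recordChi L s 43 M β) U) ∂configMeasure SU2 L
      ≤ ∫ U, CT ∂configMeasure SU2 L := integral_mono_of_nonneg (ae_of_all _ hnn) (integrable_const _) (ae_of_all _ hpt)
    _ = CT := by rw [integral_const, smul_eq_mul, probReal_univ, one_mul]
    _ ≤ _ := by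
        rw [hCTdef, mul_pow]
        have h0 : 0 ≤ ((fpZ (powScale 1 β))⁻¹ * (Real.exp (β * (2 * (Fintype.card (Edge 3 L) : ℝ))) * (Real.exp (-(β * btMnt L δ α (min (1 / 40) (powScale (1 / 2) β * btLog β)) (5 * (powScale (1 / 2) β * btLog β ^ 2)) (powScale 1 β))) + Real.exp (-(β * btMfar L δ α (min (1 / 40) (powScale (1 / 2) β * btLog β)) (powScale 1 β) P₀))) * ∫ v, (fun x : LinkSpace L => {x : LinkSpace L | linkCurry x ∈ capBalancedSet L}.indicator (fun _ => (1 : ℝ)) x * frozenProfile L (fun β' => stiffGaussExp L (β' / 2) β') (fun β' => min (1 / 40) (powScale (1 / 2) β' * btLog β')) β x) (linkEmbed L v) ∂orthoTransverse L)) ^ 2 * (1 / (Nbar * (1 - κP))) := mul_nonneg (sq_nonneg _) (div_pos one_pos hNκ).le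
        calc ((fpZ (powScale 1 β))⁻¹ * (Real.exp (β * (2 * (Fintype.card (Edge 3 L) : ℝ))) * (Real.exp (-(β * btMnt L δ α (min (1 / 40) (powScale (1 / 2) β * btLog β)) (5 * (powScale (1 / 2) β * btLog β ^ 2)) (powScale 1 β))) + Real.exp (-(β * btMfar L δ α (min (1 / 40) (powScale (1 / 2) β * btLog β)) (powScale 1 β) P₀))) * ∫ v, (fun x : LinkSpace L => {x : LinkSpace L | linkCurry x ∈ capBalancedSet L}.indicator (fun _ => (1 : ℝ)) x * frozenProfile L (fun β' => stiffGaussExp L (β' / 2) β') (fun β' => min (1 / 40) (powScale (1 / 2) β' * btLog β')) β x) (linkEmbed L v) ∂orthoTransverse L)) ^ 2 * A ^ 2 * (1 / (Nbar * (1 - κP))) = ((fpZ (powScale 1 β))⁻¹ * (Real.exp (β * (2 * (Fintype.card (Edge 3 L) : ℝ))) * (Real.exp (-(β * btMnt L δ α (min (1 / 40) (powScale (1 / 2) β * btLog β)) (5 * (powScale (1 / 2) β * btLog β ^ 2)) (powScale 1 β))) + Real.exp (-(β * btMfar L δ α (min (1 / 40) (powScale (1 / 2) β * btLog β)) (powScale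 1 β) P₀))) * ∫ v, (fun x : LinkSpace L => {x : LinkSpace L | linkCurry x ∈ capBalancedSet L}.indicator (fun _ => (1 : ℝ)) x * frozenProfile L (fun β' => stiffGaussExp L (β' / 2) β') (fun β' => min (1 / 40) (powScale (1 / 2) β' * btLog β')) β x) (linkEmbed L v) ∂orthoTransverse L)) ^ 2 * (1 / (Nbar * (1 - κP))) * A ^ 2 := by ring
          _ ≤ _ := mul_le_mul_of_nonneg_left hA2 h0

end Summit.QuantumFields.YangMills.Theorems.FemtoTransferGap.TwoLattice.ConstTube

end
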